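import Summits.BirchSwinnertonDyer.BirchSwinnertonDyer.Theorems.ThetaPartnerAtTwoSignedControlAtTwoPlusTowerTwo
import Summits.BirchSwinnertonDyer.Rank1Residual.Additive.PadicCyclotomicIntegers
import HarnessLib

/-!
# The PLUS tower at `2`, II: orthogonality of the `v_m`-power basis, `[ℚ₂(v_m) : ℚ₂] = 2^{m−2}`, and «integral elements of
# `ℚ₂(v_m) = ℚ₂(ζ_{2^m})⁺` are integral polynomials in `v_m`» — the integrality brick of the tower lemma `(T_n)` and of
# «Prop 8.11⁺ at 2» (K4 `SignedControlAtTwo`, stmt-BirchSwinnertonDyer-20309, line `eulerchar` v6, stub HONDA⁺@2)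

Route `ThetaPartnerAtTwo` (TP2; crux shared with `ResidualThetaTransportAtTwo`), crux K4, lead seat `prover-bsd-wall-tp2-p3` (g2).
Sequel of `…PlusTowerTwo` (`SignedEC.PlusTower`: `v_m = ζ_{2^m} + ζ_{2^m}⁻¹ − 2`, `v_{m+1}² + 4v_{m+1} = v_m`, `‖v_m‖^{φ(2^m)} = ‖2‖²`,
`σ₃`, `τ`). Memo of record: `Cruxes/SignedControlAtTwo/LAGPLUS-AT-2-CONSTRUCTION.md` §4 (iii), (v).

WHAT.
* §1 (any `p`, any `π ∈ ℚ̄_p` with `‖π‖^e = ‖p‖`, `e ≥ 1`) `eq_of_norm_mul_norm_pow_eq_of_pow_eq`, `norm_coeff_mul_le_norm_aeval_of_pow_eq`: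
  ORTHOGONALITY of `1, π, …, π^{e−1}` over `ℚ_p` — the O10 series' `PadicCyclotomicTower.norm_coeff_mul_le_norm_aeval` (stated there
  for `π = ζ_{p^m} − 1`, `e = φ(p^m)`) with the uniformizer and the ramification index as parameters (same proof).
* §2 (`p = 2`, `m ≥ 2`, `v_m = ζ_m + ζ_m⁻¹ − 2`, `e = 2^{m−2}`): `‖v_m‖^{2^{m−2}} = ‖2‖`; an explicit monic `Q ∈ ℚ₂[X]` of degree `2^{m−2}`
  with `Q(v_m) = 0` (iterate `X ↦ (X+2)² − 4` from `v_2 = −2`); **`natDegree (minpoly ℚ₂ v_m) = 2^{m−2}`** (upper bound from `Q`, lower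
  bound from orthogonality: a monic relation of degree `< e` is impossible); `finrank ℚ₂ ℚ₂⟮v_m⟯ = 2^{m−2}`; every `x ∈ ℚ₂⟮v_m⟯` is `r(v_m)`
  with `deg r < 2^{m−2}`; and **`exists_intPoly_aeval_v_eq`**: if moreover `‖x‖ ≤ 1` then `r` has coefficients of norm `≤ 1` — i.e.
  `𝒪_{ℚ₂(v_m)} = ℤ₂[v_m] = ⊕_{j<e} ℤ₂ v_m^j` (`v_m` is a uniformizer of the totally ramified `ℚ₂(ζ_{2^m})⁺/ℚ₂`).
These feed the tower lemma `(T_n)` (`SignedEC.Ladder.mem_closure_pow_apply_sup`, p585594: rungs `b k = v^k`, top `v^e ∈ 2𝒪`) and the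
`v_n`-coefficient bookkeeping of «Prop 8.11⁺ at 2» (memo §4 (iii)).

HONEST FRAMING: THEOREMS ONLY (no definition, no named fact, no `sorry`), route-independent; elementary local algebra in `ℚ̄₂`; closes no
item; BSD is not proved by any of this.

References: [SerreLocalFields1979] J.-P. Serre, *Local Fields*, Ch. I §6 and Ch. IV §4 (totally ramified extensions: the powers of a
uniformizer form an integral basis); [Washington1997] §13.1, Prop. 2.16; [Kobayashi2003] Prop. 8.11 (the shape of statement this serves).
-/

set_option autoImplicit false
-- the Theorems namespace of this sub repeats the summit name by design (D-0017 nested layout)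
set_option linter.dupNamespace false

noncomputable section

open scoped Classical IntermediateField
open Polynomial

namespace Summit.BirchSwinnertonDyer.BirchSwinnertonDyer.Theorems.SignedEC.PlusTower

open Summit.BirchSwinnertonDyer.Rank1Residual.Additive.PadicCyclotomicTower
  Summit.BirchSwinnertonDyer.Rank1Residual.Additive

/-! ## §1 Orthogonality of the powers of a uniformizer (`‖π‖^e = ‖p‖`) -/

section Ortho

variable (p : ℕ) [hp : Fact p.Prime]

/-- The absolute values of the non-zero terms `c π^j` (`c ∈ ℚ_p`, `j < e`) are pairwise distinct when `‖π‖^e = ‖p‖`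
(value group `p^ℤ` of `ℚ_p`). The O10 lemma `PadicCyclotomicTower.eq_of_norm_mul_norm_pow_eq` with `π`, `e` as parameters.
[cite: SerreLocalFields1979, Ch. I §6] -/
theorem eq_of_norm_mul_norm_pow_eq_of_pow_eq {π : PadicAlgCl p} {e : ℕ} (hπe : ‖π‖ ^ e = ‖(p : PadicAlgCl p)‖)
    {c c' : ℚ_[p]} (hc : c ≠ 0) (hc' : c' ≠ 0) {j j' : ℕ} (hj : j < e) (hj' : j' < e)
    (h : ‖c‖ * ‖π‖ ^ j = ‖c'‖ * ‖π‖ ^ j') : j = j' := by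
  set t : ℝ := ‖(p : PadicAlgCl p)‖ with ht
  have ht0 : 0 < t := (Literature.NumberTheory.GaloisRepresentations.PadicAlgCl.norm_natCast_prime_pos_lt_one (p := p)).1
  have ht1 : t < 1 := (Literature.NumberTheory.GaloisRepresentations.PadicAlgCl.norm_natCast_prime_pos_lt_one (p := p)).2
  have hnp : ‖(p : PadicAlgCl p)‖ = (p : ℝ)⁻¹ := by
    rw [← map_natCast (algebraMap ℚ_[p] (PadicAlgCl p)) p]
    exact (PadicAlgCl.norm_extends (p := p) (p : ℚ_[p])).trans Padic.norm_p
  have hcv : ‖c‖ = t ^ c.valuation := by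
    rw [Padic.norm_eq_zpow_neg_valuation hc, ht, hnp, inv_zpow', zpow_neg]
  have hcv' : ‖c'‖ = t ^ c'.valuation := by
    rw [Padic.norm_eq_zpow_neg_valuation hc', ht, hnp, inv_zpow', zpow_neg]
  set v : ℤ := c.valuation
  set v' : ℤ := c'.valuation
  have h2 := congrArg (fun x : ℝ => x ^ e) h
  simp only [mul_pow] at h2
  rw [← pow_mul, ← pow_mul, mul_comm j e, mul_comm j' e, pow_mul, pow_mul, hπe, hcv, hcv',
    ← zpow_natCast (t ^ v) e, ← zpow_natCast (t ^ v') e, ← zpow_mul, ← zpow_mul,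
    ← zpow_natCast t j, ← zpow_natCast t j', ← zpow_add₀ ht0.ne', ← zpow_add₀ ht0.ne'] at h2
  have hexp : v * (e : ℤ) + (j : ℤ) = v' * (e : ℤ) + (j' : ℤ) :=
    zpow_right_injective₀ ht0 ht1.ne h2
  have hdvd : (e : ℤ) ∣ (j : ℤ) - j' := ⟨v' - v, by linear_combination hexp⟩
  have habs : |(j : ℤ) - j'| < e := by
    rw [abs_sub_lt_iff]; constructor <;> omega
  have := Int.eq_zero_of_abs_lt_dvd hdvd habs
  omega

/-- **Orthogonality of the `π`-power basis**: if `‖π‖^e = ‖p‖` then for `r ∈ ℚ_p[X]` of degree `< e` every term is dominated by the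
sum, `‖r_j‖ ‖π‖^j ≤ ‖r(π)‖`. The O10 lemma `PadicCyclotomicTower.norm_coeff_mul_le_norm_aeval` with `π`, `e` as parameters.
[cite: SerreLocalFields1979, Ch. I §6] -/
theorem norm_coeff_mul_le_norm_aeval_of_pow_eq {π : PadicAlgCl p} {e : ℕ} (hπe : ‖π‖ ^ e = ‖(p : PadicAlgCl p)‖)
    (r : ℚ_[p][X]) (hr : r.natDegree < e) (j : ℕ) :
    ‖r.coeff j‖ * ‖π‖ ^ j ≤ ‖aeval π r‖ := by
  by_cases hj0 : r.coeff j = 0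
  · rw [hj0, norm_zero, zero_mul]; exact norm_nonneg _
  have hjdeg : j ≤ r.natDegree := le_natDegree_of_ne_zero hj0
  let f : ℕ → PadicAlgCl p := fun i => r.coeff i • π ^ i
  let S : Finset ℕ := (Finset.range (r.natDegree + 1)).filter fun i => r.coeff i ≠ 0
  have hsum : aeval π r = ∑ i ∈ S, f i := by
    rw [aeval_eq_sum_range, Finset.sum_filter_of_ne]
    intro i _ hi h0
    apply hi
    change r.coeff i • π ^ i = 0
    rw [h0, zero_smul]
  have hjS : j ∈ S := by
    simp only [S, Finset.mem_filter, Finset.mem_range]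
    exact ⟨Nat.lt_succ_of_le hjdeg, hj0⟩
  have hSne : S.Nonempty := ⟨j, hjS⟩
  have hnormf : ∀ i, ‖f i‖ = ‖r.coeff i‖ * ‖π‖ ^ i := fun i => by
    change ‖r.coeff i • π ^ i‖ = _
    rw [norm_smul, norm_pow]
  have hpair : Set.Pairwise (S : Set ℕ) fun i i' => ‖f i‖ ≠ ‖f i'‖ := by
    intro i hi i' hi' hii' heq
    simp only [S, Finset.coe_filter, Finset.mem_range, Set.mem_setOf_eq] at hi hi'
    rw [hnormf, hnormf] at heq
    exact hii' (eq_of_norm_mul_norm_pow_eq_of_pow_eq p hπe hi.2 hi'.2 (by omega) (by omega) heq)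
  have key : ‖∑ i ∈ S, f i‖ = S.sup' hSne (fun i => ‖f i‖) :=
    IsUltrametricDist.norm_sum_eq_sup'_of_pairwise_ne hSne hpair
  rw [hsum, key, ← hnormf j]
  exact Finset.le_sup' (fun i => ‖f i‖) hjS

/-- A monic `ℚ_p`-polynomial of degree `d < e` does not vanish at `π` with `‖π‖^e = ‖p‖`, `π ≠ 0` (orthogonality at `j = d`).
[cite: SerreLocalFields1979, Ch. I §6] -/
theorem aeval_ne_zero_of_monic_of_natDegree_lt {π : PadicAlgCl p} {e : ℕ} (hπe : ‖π‖ ^ e = ‖(p : PadicAlgCl p)‖)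
    (hπ0 : π ≠ 0) {r : ℚ_[p][X]} (hr : r.Monic) (hre : r.natDegree < e) : aeval π r ≠ 0 := by
  intro h0
  have h := norm_coeff_mul_le_norm_aeval_of_pow_eq p hπe r hre r.natDegree
  rw [h0, norm_zero, Polynomial.coeff_natDegree, hr.leadingCoeff, norm_one, one_mul] at h
  exact (pow_ne_zero _ (norm_ne_zero_iff.mpr hπ0)) (le_antisymm h (pow_nonneg (norm_nonneg _) _))

/-- **`deg minpoly_{ℚ_p} π ≥ e`** for `‖π‖^e = ‖p‖`, `π ≠ 0` integral. [cite: SerreLocalFields1979, Ch. I §6] -/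
theorem le_natDegree_minpoly_of_pow_eq {π : PadicAlgCl p} {e : ℕ} (hπe : ‖π‖ ^ e = ‖(p : PadicAlgCl p)‖) (hπ0 : π ≠ 0) :
    e ≤ (minpoly ℚ_[p] π).natDegree := by
  by_contra h
  push Not at h
  exact aeval_ne_zero_of_monic_of_natDegree_lt p hπe hπ0 (minpoly.monic (Algebra.IsIntegral.isIntegral π)) h
    (minpoly.aeval ℚ_[p] π)

end Ortho

/-! ## §2 `ℚ₂(v_m) = ℚ₂(ζ_{2^m})⁺`: degree `2^{m−2}` and the integral basis `1, v_m, …, v_m^{2^{m−2}−1}` -/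

/-- **`‖v_m‖^{2^{m−2}} = ‖2‖`** (`m ≥ 2`; from `‖v_m‖^{φ(2^m)} = ‖2‖²`). [cite: SerreLocalFields1979, Ch. IV §4] -/
theorem norm_v_pow_eq {m : ℕ} (hm : 2 ≤ m) :
    ‖zeta 2 m + (zeta 2 m)⁻¹ - 2‖ ^ 2 ^ (m - 2) = ‖(2 : PadicAlgCl 2)‖ := by
  have h := norm_v_pow (m := m) (by omega)
  have htot : (2 ^ m).totient = 2 ^ (m - 2) * 2 := by
    rw [Nat.totient_prime_pow Nat.prime_two (by omega)]
    obtain ⟨m', rfl⟩ := Nat.exists_eq_add_of_le' hm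
    rw [show m' + 2 - 1 = m' + 1 by omega, show m' + 2 - 2 = m' by omega, pow_succ, show 2 - 1 = 1 from rfl, mul_one]
  rw [htot, pow_mul] at h
  exact (pow_left_inj₀ (pow_nonneg (norm_nonneg _) _) (norm_nonneg _) two_ne_zero).mp h

/-- `v_m ≠ 0` for `m ≥ 2` (its absolute value is that of a uniformizer). [folklore] -/
theorem v_ne_zero {m : ℕ} (hm : 2 ≤ m) : zeta 2 m + (zeta 2 m)⁻¹ - 2 ≠ 0 := by
  intro h
  have h1 := norm_v_pow_eq hm
  rw [h, norm_zero, zero_pow (pow_ne_zero _ two_ne_zero)] at h1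
  have := (Literature.NumberTheory.GaloisRepresentations.PadicAlgCl.norm_natCast_prime_pos_lt_one (p := 2)).1
  have h2 : ‖((2 : ℕ) : PadicAlgCl 2)‖ = ‖(2 : PadicAlgCl 2)‖ := by norm_cast
  rw [h2, ← h1] at this
  exact lt_irrefl _ this

/-- **An explicit annihilating polynomial**: a monic `Q ∈ ℚ₂[X]` of degree `2^{m−2}` with `Q(v_m) = 0` (`m ≥ 2`): `Q_2 = X + 2`
(`v_2 = −2`), `Q_{m+1} = Q_m((X + 2)² − 4) = Q_m(X² + 4X)` (`v_{m+1}² + 4v_{m+1} = v_m`). [cite: Washington1997, §13.1] -/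
theorem exists_monic_aeval_v_eq_zero {m : ℕ} (hm : 2 ≤ m) :
    ∃ Q : ℚ_[2][X], Q.Monic ∧ Q.natDegree = 2 ^ (m - 2) ∧
      aeval (zeta 2 m + (zeta 2 m)⁻¹ - 2) Q = 0 := by
  obtain ⟨m', rfl⟩ := Nat.exists_eq_add_of_le' hm
  clear hm
  induction m' with
  | zero =>
    refine ⟨X + C 2, monic_X_add_C 2, by rw [natDegree_X_add_C]; rfl, ?_⟩
    rw [map_add, aeval_X, aeval_C]
    show zeta 2 2 + (zeta 2 2)⁻¹ - 2 + algebraMap ℚ_[2] (PadicAlgCl 2) 2 = 0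
    rw [u_two, map_ofNat]; ring
  | succ m' ih =>
    obtain ⟨Q, hQm, hQd, hQ0⟩ := ih
    have hlt : (C (4 : ℚ_[2]) * X).degree < ((X : ℚ_[2][X]) ^ 2).degree := by
      rw [degree_X_pow]
      exact (degree_C_mul_X_le _).trans_lt (by exact_mod_cast one_lt_two)
    have hS : (X ^ 2 + C (4 : ℚ_[2]) * X : ℚ_[2][X]).Monic := (monic_X_pow 2).add_of_left hlt
    have hSd : (X ^ 2 + C (4 : ℚ_[2]) * X : ℚ_[2][X]).natDegree = 2 := by
      rw [natDegree_add_eq_left_of_degree_lt hlt, natDegree_X_pow]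
    refine ⟨Q.comp (X ^ 2 + C 4 * X), hQm.comp hS (by rw [hSd]; norm_num), ?_, ?_⟩
    · rw [natDegree_comp, hQd, hSd, show m' + 2 - 2 = m' by omega, show m' + 1 + 2 - 2 = m' + 1 by omega, pow_succ]
    · have key : (zeta 2 (m' + 1 + 2) + (zeta 2 (m' + 1 + 2))⁻¹ - 2) ^ 2 +
          algebraMap ℚ_[2] (PadicAlgCl 2) 4 * (zeta 2 (m' + 1 + 2) + (zeta 2 (m' + 1 + 2))⁻¹ - 2) =
          zeta 2 (m' + 2) + (zeta 2 (m' + 2))⁻¹ - 2 := by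
        rw [map_ofNat]; exact v_succ_sq_add (m' + 2)
      rw [aeval_comp, map_add, map_pow, aeval_X, map_mul, aeval_C, aeval_X, key]
      exact hQ0

/-- **`deg minpoly_{ℚ₂} v_m = 2^{m−2}`** (`m ≥ 2`). [cite: SerreLocalFields1979, Ch. IV §4] [cite: Washington1997, Prop. 2.16] -/
theorem natDegree_minpoly_v {m : ℕ} (hm : 2 ≤ m) :
    (minpoly ℚ_[2] (zeta 2 m + (zeta 2 m)⁻¹ - 2)).natDegree = 2 ^ (m - 2) := by
  have hint : IsIntegral ℚ_[2] (zeta 2 m + (zeta 2 m)⁻¹ - 2) := Algebra.IsIntegral.isIntegral _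
  refine le_antisymm ?_ ?_
  · obtain ⟨Q, hQm, hQd, hQ0⟩ := exists_monic_aeval_v_eq_zero hm
    rw [← hQd]
    exact natDegree_le_natDegree (minpoly.min ℚ_[2] _ hQm hQ0)
  · have h2 : ‖((2 : ℕ) : PadicAlgCl 2)‖ = ‖(2 : PadicAlgCl 2)‖ := by norm_cast
    exact le_natDegree_minpoly_of_pow_eq 2 ((norm_v_pow_eq hm).trans h2.symm) (v_ne_zero hm)

/-- **`[ℚ₂(v_m) : ℚ₂] = 2^{m−2}`** (`m ≥ 2`). [cite: Washington1997, §13.1] -/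
theorem finrank_adjoin_v {m : ℕ} (hm : 2 ≤ m) :
    Module.finrank ℚ_[2] ℚ_[2]⟮zeta 2 m + (zeta 2 m)⁻¹ - 2⟯ = 2 ^ (m - 2) := by
  rw [IntermediateField.adjoin.finrank (Algebra.IsIntegral.isIntegral _), natDegree_minpoly_v hm]

/-- Elements of `ℚ₂(v_m)` are polynomials in `v_m` of degree `< 2^{m−2}`. [folklore] -/
theorem exists_aeval_v_eq {m : ℕ} (hm : 2 ≤ m) {x : PadicAlgCl 2} (hx : x ∈ ℚ_[2]⟮zeta 2 m + (zeta 2 m)⁻¹ - 2⟯) :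
    ∃ r : ℚ_[2][X], r.natDegree < 2 ^ (m - 2) ∧ aeval (zeta 2 m + (zeta 2 m)⁻¹ - 2) r = x := by
  set v := zeta 2 m + (zeta 2 m)⁻¹ - 2 with hv
  have halg : IsAlgebraic ℚ_[2] v := Algebra.IsAlgebraic.isAlgebraic _
  have hx' : x ∈ (ℚ_[2]⟮v⟯).toSubalgebra := hx
  rw [IntermediateField.adjoin_simple_toSubalgebra_of_isAlgebraic halg, Algebra.adjoin_singleton_eq_range_aeval] at hx'
  obtain ⟨q, rfl⟩ := hx'
  have hmonic : (minpoly ℚ_[2] v).Monic := minpoly.monic (Algebra.IsIntegral.isIntegral _)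
  have h1 : minpoly ℚ_[2] v ≠ 1 := by
    intro h
    have := congrArg natDegree h
    rw [natDegree_minpoly_v hm, natDegree_one] at this
    exact pow_ne_zero _ two_ne_zero this
  refine ⟨q %ₘ minpoly ℚ_[2] v, ?_, ?_⟩
  · rw [← natDegree_minpoly_v hm]
    exact natDegree_modByMonic_lt q hmonic h1
  · exact aeval_modByMonic_eq_self_of_root (minpoly.aeval ℚ_[2] v)

/-- **`𝒪_{ℚ₂(v_m)} = ℤ₂[v_m]`**: an element of `ℚ₂(v_m)` of norm `≤ 1` is `r(v_m)` for an `r ∈ ℚ₂[X]` of degree `< 2^{m−2}` with all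
coefficients of norm `≤ 1` (`‖r_j‖ ‖v‖^j ≤ ‖x‖ ≤ 1` and `‖v‖^j > ‖v‖^e = ‖2‖`, so `‖r_j‖ < 2`). [cite: SerreLocalFields1979, Ch. I §6 Prop. 18] -/
theorem exists_intPoly_aeval_v_eq {m : ℕ} (hm : 2 ≤ m) {x : PadicAlgCl 2} (hx : x ∈ ℚ_[2]⟮zeta 2 m + (zeta 2 m)⁻¹ - 2⟯)
    (hx1 : ‖x‖ ≤ 1) :
    ∃ r : ℚ_[2][X], r.natDegree < 2 ^ (m - 2) ∧ (∀ j, ‖r.coeff j‖ ≤ 1) ∧ aeval (zeta 2 m + (zeta 2 m)⁻¹ - 2) r = x := by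
  obtain ⟨r, hr, hrx⟩ := exists_aeval_v_eq hm hx
  set v := zeta 2 m + (zeta 2 m)⁻¹ - 2 with hv
  set e := 2 ^ (m - 2) with he
  have h2 : ‖((2 : ℕ) : PadicAlgCl 2)‖ = ‖(2 : PadicAlgCl 2)‖ := by norm_cast
  have hve : ‖v‖ ^ e = ‖((2 : ℕ) : PadicAlgCl 2)‖ := (norm_v_pow_eq hm).trans h2.symm
  have hv0 : 0 < ‖v‖ := norm_pos_iff.mpr (v_ne_zero hm)
  have hv1 : ‖v‖ < 1 := by
    have ht1 := (Literature.NumberTheory.GaloisRepresentations.PadicAlgCl.norm_natCast_prime_pos_lt_one (p := 2)).2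
    by_contra hge
    push Not at hge
    have : (1 : ℝ) ≤ ‖v‖ ^ e := one_le_pow₀ hge
    rw [hve] at this
    exact absurd ht1 (not_lt.mpr this)
  refine ⟨r, hr, fun j ↦ ?_, hrx⟩
  by_cases hj : r.natDegree < j
  · rw [coeff_eq_zero_of_natDegree_lt hj, norm_zero]; exact zero_le_one
  push Not at hj
  have hje : j < e := lt_of_le_of_lt hj hr
  have horth := norm_coeff_mul_le_norm_aeval_of_pow_eq 2 hve r hr j
  rw [hrx] at horth
  have hvj : 0 < ‖v‖ ^ j := pow_pos hv0 j
  have h1 : ‖r.coeff j‖ ≤ (‖v‖ ^ j)⁻¹ := by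
    rw [inv_eq_one_div, le_div_iff₀ hvj]
    exact horth.trans hx1
  have hnp : ‖((2 : ℕ) : PadicAlgCl 2)‖ = ((2 : ℕ) : ℝ)⁻¹ := by
    rw [← map_natCast (algebraMap ℚ_[2] (PadicAlgCl 2)) 2]
    exact (PadicAlgCl.norm_extends (p := 2) ((2 : ℕ) : ℚ_[2])).trans Padic.norm_p
  have hlt : ((2 : ℕ) : ℝ)⁻¹ < ‖v‖ ^ j := by
    rw [← hnp, ← hve]
    exact pow_lt_pow_right_of_lt_one₀ hv0 hv1 hje
  refine norm_le_one_of_norm_lt_p 2 (h1.trans_lt ?_)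
  have hp0 : (0 : ℝ) < (2 : ℕ) := by norm_num
  calc (‖v‖ ^ j)⁻¹ < (((2 : ℕ) : ℝ)⁻¹)⁻¹ := inv_strictAnti₀ (inv_pos.mpr hp0) hlt
    _ = (2 : ℕ) := inv_inv _

end Summit.BirchSwinnertonDyer.BirchSwinnertonDyer.Theorems.SignedEC.PlusTower

end
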